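import Mathlib.Analysis.InnerProductSpace.PiL2
import Literature.Geometry.Lorentzian.Basic

/-!
# Route EIHFluxBalance — crux `InertialRecession` (E′), line `SketchCleanExcision`:
# the staircase, part 3 — geometry of a static window cover during one step

Helper file for the crux `stmt-FinalStateConjecture-17403`
(`Summit.FinalStateConjecture.FinalStateConjecture.Theses.EIHFluxBalance.InertialRecession`), registered stub
`stub_integratedClusterBalance` (skeleton r12, `Cruxes/InertialRecession/Lines/SketchCleanExcision.lean`).

A COVER of the member set `S` is created at time `s₀` from a gap scale `σ` of the configuration `ξ · s₀`
(part 1): one window per class, centred at the representative's position `ξ p s₀`, radius `4σ`. It is then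
HELD STATIC and observed at times `s ∈ [s₀, s₀ + σ/4]`. With `2`-Lipschitz centres and `16σ` below the
isolation scale of `S` at `s₀`, every member of the class of `p` stays within `3σ/2` of the centre
(`norm_sub_centre_le_of_rep_eq`) while every other centre — the rest of `S` and all outsiders — stays beyond
`31σ/2` (`le_norm_sub_centre_of_rep_ne`, `le_norm_sub_centre_of_not_mem`); hence each window is admissible
with clearance `δ = 1/8` (`admissible_window`), its member set is exactly the class (`mem_class_iff_inside`),
it lies in the middle cone (`cone_window`) and above the threshold `ρ = c_ρ · gsc` (`threshold_window`).
Elementary metric inequalities; Mathlib only. [folklore]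
-/

noncomputable section

set_option linter.dupNamespace false

open scoped BigOperators Classical
open Finset

namespace Summit.FinalStateConjecture.FinalStateConjecture.Theorems.SublinearIsFree.Staircase

open Literature.Geometry.Lorentzian

/-! This file is parametrised by an abstract class map `rep` with set of representatives `Rp ⊆ S` and an
abstract isolation bound `iso`; parts 1–2 supply them (`rep`, `reps`, `isol`). -/

variable {N : ℕ}

section Window

variable {ξ : Fin N → ℝ → E3} {S : Finset (Fin N)} {T s₀ s σ : ℝ}
  (hlip : ∀ i s s', T ≤ s → T ≤ s' → ‖ξ i s - ξ i s'‖ ≤ 2 * |s - s'|)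
  (hT : T ≤ s₀) (hs : s₀ ≤ s) (hs' : s ≤ s₀ + σ / 4)

include hlip hT hs hs'

/-- During a step every centre moves by at most `σ/2`. [folklore] -/
theorem norm_sub_self_le (i : Fin N) : ‖ξ i s - ξ i s₀‖ ≤ σ / 2 := by
  have h := hlip i s s₀ (hT.trans hs) hT
  rw [abs_of_nonneg (by linarith)] at h
  linarith

/-- A member of the class of `p` (distance `< σ` at creation) stays within `3σ/2` of the static centre.
[folklore] -/
theorem norm_sub_centre_le_of_lt {j p : Fin N} (hjp : ‖ξ j s₀ - ξ p s₀‖ < σ) :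
    ‖ξ j s - ξ p s₀‖ ≤ 3 * σ / 2 := by
  have h1 := norm_sub_self_le hlip hT hs hs' j
  calc ‖ξ j s - ξ p s₀‖ = ‖(ξ j s - ξ j s₀) + (ξ j s₀ - ξ p s₀)‖ := by congr 1; abel
    _ ≤ ‖ξ j s - ξ j s₀‖ + ‖ξ j s₀ - ξ p s₀‖ := norm_add_le _ _
    _ ≤ σ / 2 + σ := by gcongr
    _ = 3 * σ / 2 := by ring

/-- A centre at distance `≥ 16σ` at creation stays beyond `31σ/2` of the static centre. [folklore] -/
theorem le_norm_sub_centre_of_le {j p : Fin N} (hjp : 16 * σ ≤ ‖ξ j s₀ - ξ p s₀‖) :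
    31 * σ / 2 ≤ ‖ξ j s - ξ p s₀‖ := by
  have h1 := norm_sub_self_le hlip hT hs hs' j
  have : ‖ξ j s₀ - ξ p s₀‖ ≤ ‖ξ j s - ξ p s₀‖ + ‖ξ j s - ξ j s₀‖ := by
    calc ‖ξ j s₀ - ξ p s₀‖ = ‖(ξ j s - ξ p s₀) - (ξ j s - ξ j s₀)‖ := by congr 1; abel
      _ ≤ _ := norm_sub_le _ _
  linarith

end Window

section Cover

variable {ξ : Fin N → ℝ → E3} {S : Finset (Fin N)} {T s₀ s σ : ℝ} {rep : Fin N → Fin N} {Rp : Finset (Fin N)}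
  {iso : ℝ}
  (hlip : ∀ i s s', T ≤ s → T ≤ s' → ‖ξ i s - ξ i s'‖ ≤ 2 * |s - s'|)
  (hT : T ≤ s₀) (hs : s₀ ≤ s) (hs' : s ≤ s₀ + σ / 4)
  -- the class map of the gap scale `σ` at time `s₀` (part 1: `rep`, `reps`, `rep_eq_iff`, …)
  (hRpS : Rp ⊆ S)
  (hclose : ∀ j ∈ S, ∀ p ∈ Rp, rep j = p → ‖ξ j s₀ - ξ p s₀‖ < σ)
  (hfar : ∀ j ∈ S, ∀ p ∈ Rp, rep j ≠ p → 16 * σ ≤ ‖ξ j s₀ - ξ p s₀‖)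
  -- the isolation scale of `S` at `s₀` (part 2: `isol`, `isol_le_norm_sub`)
  (hisoS : ∀ i ∈ S, ∀ j ∉ S, iso ≤ ‖ξ i s₀ - ξ j s₀‖) (hσiso : 16 * σ ≤ iso)

include hlip hT hs hs'

section Members

include hclose

/-- Members of the class of `p` stay within `3σ/2` of the static centre `ξ p s₀`. [folklore] -/
theorem norm_sub_centre_le_of_rep_eq {j p : Fin N} (hj : j ∈ S) (hp : p ∈ Rp) (h : rep j = p) :
    ‖ξ j s - ξ p s₀‖ ≤ 3 * σ / 2 :=
  norm_sub_centre_le_of_lt hlip hT hs hs' (hclose j hj p hp h)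

end Members

section NonMembers

include hfar

/-- Members of OTHER classes stay beyond `31σ/2`. [folklore] -/
theorem le_norm_sub_centre_of_rep_ne {j p : Fin N} (hj : j ∈ S) (hp : p ∈ Rp) (h : rep j ≠ p) :
    31 * σ / 2 ≤ ‖ξ j s - ξ p s₀‖ :=
  le_norm_sub_centre_of_le hlip hT hs hs' (hfar j hj p hp h)

end NonMembers

section Outsiders

include hRpS hisoS hσiso

/-- OUTSIDERS stay beyond `31σ/2` (the cover was built `16σ` below the isolation scale). [folklore] -/
theorem le_norm_sub_centre_of_not_mem {j p : Fin N} (hj : j ∉ S) (hp : p ∈ Rp) :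
    31 * σ / 2 ≤ ‖ξ j s - ξ p s₀‖ := by
  refine le_norm_sub_centre_of_le hlip hT hs hs' (hσiso.trans ?_)
  rw [norm_sub_rev]
  exact hisoS p (hRpS hp) j hj

end Outsiders

include hRpS hclose hfar hisoS hσiso

/-- **ADMISSIBILITY with clearance `1/8`**: every centre is within `(1 − 1/8)·4σ` of a static window centre or
beyond `(1 + 1/8)·4σ`. [folklore] -/
theorem admissible_window (hσ : 0 < σ) {p : Fin N} (hp : p ∈ Rp) (j : Fin N) :
    ‖ξ j s - ξ p s₀‖ ≤ (1 - 1 / 8) * (4 * σ) ∨ (1 + 1 / 8) * (4 * σ) ≤ ‖ξ j s - ξ p s₀‖ := by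
  by_cases hj : j ∈ S
  · by_cases h : rep j = p
    · left
      have := norm_sub_centre_le_of_rep_eq hlip hT hs hs' hclose hj hp h
      linarith
    · right
      have := le_norm_sub_centre_of_rep_ne hlip hT hs hs' hfar hj hp h
      linarith
  · right
    have := le_norm_sub_centre_of_not_mem hlip hT hs hs' hRpS hisoS hσiso hj hp
    linarith

/-- **THE MEMBER SET OF A WINDOW IS ITS CLASS** at every time of the step. [folklore] -/
theorem mem_class_iff_inside (hσ : 0 < σ) {p : Fin N} (hp : p ∈ Rp) (j : Fin N) :
    j ∈ S.filter (fun j ↦ rep j = p) ↔ ‖ξ j s - ξ p s₀‖ ≤ (1 - 1 / 8) * (4 * σ) := by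
  rw [Finset.mem_filter]
  constructor
  · rintro ⟨hj, h⟩
    have := norm_sub_centre_le_of_rep_eq hlip hT hs hs' hclose hj hp h
    linarith
  · intro h
    by_contra hc
    rw [not_and] at hc
    by_cases hj : j ∈ S
    · have := le_norm_sub_centre_of_rep_ne hlip hT hs hs' hfar hj hp (hc hj)
      linarith
    · have := le_norm_sub_centre_of_not_mem hlip hT hs hs' hRpS hisoS hσiso hj hp
      linarith

/-- Inside a window means: a member of `S` in the class of `p`. [folklore] -/
theorem mem_and_rep_eq_of_inside (hσ : 0 < σ) {p : Fin N} (hp : p ∈ Rp) {j : Fin N}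
    (h : ‖ξ j s - ξ p s₀‖ ≤ (1 - 1 / 8) * (4 * σ)) : j ∈ S ∧ rep j = p := by
  have := (mem_class_iff_inside hlip hT hs hs' hRpS hclose hfar hisoS hσiso hσ hp j).mpr h
  simpa [Finset.mem_filter] using this

end Cover

section Cone

variable {ξ : Fin N → ℝ → E3} {T s₀ s σ κ iso : ℝ}

/-- **THE WINDOWS LIE IN THE MIDDLE CONE**: `‖ξ p s₀‖ + 4σ ≤ (κ+κ²)s/2` whenever the centre is in the cone
`κ²s₀` and `16σ ≤ iso ≤ c₀ s₀`, `c₀ = (κ − κ²)/2`. [folklore] -/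
theorem cone_window (hκ : 0 < κ) (hκ1 : κ < 1) (hs₀ : 0 ≤ s₀) (hs : s₀ ≤ s) {p : Fin N}
    (hcone : ‖ξ p s₀‖ ≤ κ ^ 2 * s₀) (hσiso : 16 * σ ≤ iso) (hisoc : iso ≤ (κ - κ ^ 2) / 2 * s₀) :
    ‖ξ p s₀‖ + 4 * σ ≤ (κ + κ ^ 2) / 2 * s := by
  have hk : 0 ≤ κ - κ ^ 2 := by nlinarith
  have h1 : (κ + κ ^ 2) / 2 * s₀ ≤ (κ + κ ^ 2) / 2 * s := by
    apply mul_le_mul_of_nonneg_left hs; positivity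
  nlinarith

end Cone

section Threshold

variable {ξ : Fin N → ℝ → E3} {s₀ s σ cρ lam isoS₀ isoS : ℝ} {ρ gs : ℝ → ℝ}

/-- **THE WINDOWS ARE ABOVE THE THRESHOLD**: with `ρ = c_ρ·gsc`, `gsc ≤ isol`, the one-sided Lipschitz bound
`isol s ≤ isol s₀ + 4(s − s₀)`, `s − s₀ ≤ σ/4`, `16σ ≤ isol s₀`, the gap-scale floor `λ·isol s₀ ≤ σ` and
`c_ρ ≤ λ/4`: `ρ s ≤ (1/8)·(4σ)`. [folklore] -/
theorem threshold_window (hρ : ρ s = cρ * gs s) (hcρ : 0 ≤ cρ) (hcρl : cρ ≤ lam / 4)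
    (hgs : gs s ≤ isoS) (hlipiso : isoS ≤ isoS₀ + 4 * (s - s₀)) (hs' : s ≤ s₀ + σ / 4)
    (hσiso : 16 * σ ≤ isoS₀) (hlam : lam * isoS₀ ≤ σ) (hσ : 0 < σ) :
    ρ s ≤ 1 / 8 * (4 * σ) := by
  rw [hρ]
  have h1 : gs s ≤ 2 * isoS₀ := by linarith
  have h2 : 0 ≤ isoS₀ := by linarith
  calc cρ * gs s ≤ cρ * (2 * isoS₀) := mul_le_mul_of_nonneg_left h1 hcρ
    _ ≤ (lam / 4) * (2 * isoS₀) := mul_le_mul_of_nonneg_right hcρl (by linarith)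
    _ = (lam * isoS₀) / 2 := by ring
    _ ≤ σ / 2 := by linarith
    _ = 1 / 8 * (4 * σ) := by ring

end Threshold

/-- Registered one-line form (carrier `cone_window_sce12` of the crux item) of `cone_window`. [folklore] -/
theorem cone_window_sce12 : open Literature.Geometry.Lorentzian in ∀ (N : ℕ) (ξ : Fin N → ℝ → E3) (s₀ s σ κ iso : ℝ) (p : Fin N), 0 < κ → κ < 1 → 0 ≤ s₀ → s₀ ≤ s → ‖ξ p s₀‖ ≤ κ ^ 2 * s₀ → 16 * σ ≤ iso → iso ≤ (κ - κ ^ 2) / 2 * s₀ → ‖ξ p s₀‖ + 4 * σ ≤ (κ + κ ^ 2) / 2 * s :=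
  fun _ _ _ _ _ _ _ _ hκ hκ1 hs₀ hs hcone hσiso hisoc ↦ cone_window hκ hκ1 hs₀ hs hcone hσiso hisoc

end Summit.FinalStateConjecture.FinalStateConjecture.Theorems.SublinearIsFree.Staircase

end
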